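import Literature.MathematicalPhysics.QuantumFieldTheory.Federbush1986.PhaseCellIVIntrinsicMetric

/-!
# `Federbush1986.PhaseCellIVBiLipschitzTransfer` — [Federbush1988PhaseCellIV] Appendix A, Theorems A.1 (p. 339) and A.2 (p. 341)
# for an ABSTRACT compact Riemannian manifold: the record decls `PhaseCellIVAppA.ThmA1 n I M` / `ThmA2 n I M` (p242861) PROVED
# under a **bi-Lipschitz** embedding hypothesis (any embedding distorting the Riemannian distance by bounded factors), weakening
# the ISOMETRIC hypothesis `IsMetricEmbedding` of `PhaseCellIVIntrinsicMetric` §10 (p321140)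

statement-level skeleton of published theorems with citation tags; proofs where landed; nothing here is a claim about the Yang–Mills mass gap

CITATION HEADER.  P. Federbush, *A phase cell approach to Yang–Mills theory. IV. The choice of variables*, Commun. Math.
Phys. **114** (1988) 317–343 [bib `Federbush1988PhaseCellIV`; doi:10.1007/bf01225039; lit store `paper:doi-10-1007-bf01225039`;
journal page = PDF page + 316], Appendix A p. 339 [PDF 23] (Theorem A.1), p. 341 [PDF 25] (Theorem A.2), p. 342 [PDF 26] («We now
embed `M` in some Euclidean space `Rᵗ`»), read as images (renders `run/shared/lean/pub/lit-balaban/lit-balaban-r19/renders/f4/`).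
Cell `lit-balaban`, reader/typer block **r19 gen 12** (F4 fold owner, `ROWS-F4.md`); SKELETON rows **F4.ThmA.1**, **F4.ThmA.2**
(cells: the residual hypothesis of the abstract record decls, cell ruling G.5-49 (c)).  Companion of `PhaseCellIVIntrinsicMetric`
(p319885 … p321402: `ThmA1Len`/`ThmA2Len` proved for every compact `C^∞` submanifold with its intrinsic metric; §10 the record
decls under `IsMetricEmbedding`).

WHAT IS PRINTED.  Theorem A.1 p. 339: «Let `M` be a compact differentiable manifold (without boundary) and provided with a
Riemannian metric. … *For each constant `c₁`, there is a constant `c₂ = c₂(c₁)`, such that if `f` is any homotopically trivial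
mapping from `∂D` into `M` satisfying `Λ₁(f) ≤ c₁` (A.1) there is an extension of `f`, `f^e`, mapping `D` into `M`, satisfying
`Λ₁(f^e) ≤ c₂ Λ₁(f)` (A.2).*»  Theorem A.2 p. 341 (constants `ε_M`, `c₁`, `c₂`, displays (A.18)–(A.19)).  p. 342: «We now embed `M`
in some Euclidean space `Rᵗ`».  p. 339 (proof of A.1): «one can set things up so that the inclusions of these Euclidean cubes
into `M` have universally bounded differential, and likewise the inverse mappings have universally bounded differential.  Thus
if (A.2) holds for mappings into `M′ = Rˢ` for some constant `c` …, then (A.2) will hold in the context of the theorem for some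
constant `c′`».

WHY THIS FILE.  Every constant of Theorems A.1/A.2 is EXISTENTIAL (`c₂(c₁)`; `ε_M, c₁, c₂`), and the quantities `Λ₁` ((11.4)) and
`d^M` ((A.17)) change by at most the factor `L` under post-composition with an `L`-Lipschitz map and by at most `L′` back under
an `L′`-antilipschitz one.  Hence the two theorems transfer from the image `e(M) ⊂ Rᵗ` (with its intrinsic metric, where the
tree PROVES them: `thmA1Len_of_submanifold`, `thmA2Len_of_submanifold`) to the abstract `M` along ANY embedding `e` that is
Lipschitz and antilipschitz between the Riemannian distance of `M` and the intrinsic distance of `e(M)` — print's own mechanism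
«universally bounded differential, and likewise the inverse mappings» (p. 339), applied to the embedding of p. 342.  The
§10 transfer of `PhaseCellIVIntrinsicMetric` asked for an ISOMETRY (`IsMetricEmbedding.edist_eq`), i.e. for the Nash (1956) /
Günther (1989) `C¹`-isometric embedding theorem as the unformalised identification (G.5-49 (c)); the bi-Lipschitz hypothesis of
this file is met by EVERY smooth embedding of a compact Riemannian manifold (a `C¹` injective immersion of a compact manifold
distorts lengths of curves by factors bounded above and below — compactness and continuity of the differential; the embedding
itself is Whitney's, in Mathlib as `exists_embedding_euclidean_of_compact`).  That remaining step (bounded length distortion for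
Mathlib's `riemannianEDist`) is NOT formalised here: as in §10, the embedding is an explicit HYPOTHESIS, now a weaker one.
**v1.1 (docstring only, r19 gen 32):** that remaining step IS NOW FORMALISED, in the companion
`Federbush1986.PhaseCellIVWhitneyBiLipschitz` (p334327, which imports this file): `isBiLipschitzEmbedding_of_contMDiff` (every
smooth embedding with injective differential of a compact boundaryless Riemannian manifold is an `IsBiLipschitzEmbedding`),
`exists_isBiLipschitzEmbedding` (Whitney), hence the record decls WITHOUT hypothesis: `thmA1_holds : ThmA1 n J M`,
`thmA2_holds : ThmA2 n J M`.  In THIS file the embedding remains an explicit hypothesis (no declaration changed).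

WHAT THIS MODULE PROVIDES (namespace `PhaseCellIVAppA`): `lipConst_comp_le_mul`, `supDist_comp_le_mul` (`Λ₁`, `d^M` under an
`L`-Lipschitz post-composition), `lipConst_le_mul_comp`, `supDist_le_mul_comp` (under an `L′`-antilipschitz one); structure
`IsBiLipschitzEmbedding d e` (image a `C^∞` submanifold of dimension `d`; `toIntrinsicRange e` Lipschitz and antilipschitz) with
`continuous`, `isCompact_range`, `injective`, `ofIntrinsicRange_toIntrinsicRange`, and `IsMetricEmbedding.isBiLipschitzEmbedding`
(§10's hypothesis is the case `L = L′ = 1`); **`thmA1_of_isBiLipschitzEmbedding : IsBiLipschitzEmbedding d e → ThmA1 n J M`**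
(constant `c₂′ = L′·c₂(L c₁)·L`), **`thmA2_of_isBiLipschitzEmbedding : IsBiLipschitzEmbedding d e → ThmA2 n J M`** (constants
`ε_M/L`, `L′c₁L`, `L′c₂L`); the §10 theorems re-derived as corollaries (`thmA1_of_isMetricEmbedding'`, `thmA2_of_isMetricEmbedding'`).
No `Prop`-valued definitions besides the structure (a hypothesis shape, inhabited: `IsMetricEmbedding.isBiLipschitzEmbedding` ∘
`IsMetricEmbedding.inclusion`); no named facts; axioms standard.
-/

namespace Literature.MathematicalPhysics.QuantumFieldTheory.Federbush1986

noncomputable section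

open Set Metric Function
open scoped NNReal ENNReal ContDiff Manifold Topology

namespace PhaseCellIVAppA

open Intrinsic Literature.AlgebraicGeometry.RealAlgebraic

/-! ## §1 `Λ₁` and `d^M` under Lipschitz and antilipschitz post-composition («universally bounded differential, and likewise
the inverse mappings», p. 339) -/

section Comparison

variable {X Y Z W : Type*} [PseudoEMetricSpace X] [PseudoEMetricSpace Y] [PseudoEMetricSpace Z]

/-- `Λ₁(ψ ∘ φ) ≤ L·Λ₁(φ)` for an `L`-Lipschitz `ψ`. [cite: Federbush1988PhaseCellIV, (11.4) p. 337; proof of Theorem A.1 p. 339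
(«universally bounded differential»)] -/
theorem lipConst_comp_le_mul {ψ : Y → Z} {K : ℝ≥0} (hψ : LipschitzWith K ψ) (φ : X → Y) :
    lipConst (ψ ∘ φ) ≤ K * lipConst φ := by
  simp only [lipConst]
  refine iSup₂_le fun x y => ?_
  calc edist ((ψ ∘ φ) x) ((ψ ∘ φ) y) / edist x y ≤ (K * edist (φ x) (φ y)) / edist x y :=
        ENNReal.div_le_div_right (hψ (φ x) (φ y)) _
    _ = K * (edist (φ x) (φ y) / edist x y) := mul_div_assoc _ _ _
    _ ≤ K * ⨆ (x : X) (y : X), edist (φ x) (φ y) / edist x y := by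
        gcongr
        exact le_iSup₂ (f := fun x y => edist (φ x) (φ y) / edist x y) x y

/-- `d^M(ψ ∘ g₁, ψ ∘ g₂) ≤ L·d^M(g₁, g₂)` for an `L`-Lipschitz `ψ`. [cite: Federbush1988PhaseCellIV, (A.17) p. 341; p. 339] -/
theorem supDist_comp_le_mul {ψ : Y → Z} {K : ℝ≥0} (hψ : LipschitzWith K ψ) (g₁ g₂ : W → Y) :
    supDist (ψ ∘ g₁) (ψ ∘ g₂) ≤ K * supDist g₁ g₂ := by
  simp only [supDist]
  refine iSup_le fun x => ?_
  calc edist ((ψ ∘ g₁) x) ((ψ ∘ g₂) x) ≤ K * edist (g₁ x) (g₂ x) := hψ (g₁ x) (g₂ x)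
    _ ≤ K * ⨆ x, edist (g₁ x) (g₂ x) := by
        gcongr
        exact le_iSup (fun x => edist (g₁ x) (g₂ x)) x

/-- `Λ₁(φ) ≤ L′·Λ₁(ψ ∘ φ)` for an `L′`-antilipschitz `ψ` («likewise the inverse mappings have universally bounded
differential», p. 339). [cite: Federbush1988PhaseCellIV, (11.4) p. 337; proof of Theorem A.1 p. 339] -/
theorem lipConst_le_mul_comp {ψ : Y → Z} {K : ℝ≥0} (hψ : AntilipschitzWith K ψ) (φ : X → Y) :
    lipConst φ ≤ K * lipConst (ψ ∘ φ) := by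
  simp only [lipConst]
  refine iSup₂_le fun x y => ?_
  calc edist (φ x) (φ y) / edist x y ≤ (K * edist (ψ (φ x)) (ψ (φ y))) / edist x y :=
        ENNReal.div_le_div_right (hψ (φ x) (φ y)) _
    _ = K * (edist ((ψ ∘ φ) x) ((ψ ∘ φ) y) / edist x y) := mul_div_assoc _ _ _
    _ ≤ K * ⨆ (x : X) (y : X), edist ((ψ ∘ φ) x) ((ψ ∘ φ) y) / edist x y := by
        gcongr
        exact le_iSup₂ (f := fun x y => edist ((ψ ∘ φ) x) ((ψ ∘ φ) y) / edist x y) x y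

/-- `d^M(g₁, g₂) ≤ L′·d^M(ψ ∘ g₁, ψ ∘ g₂)` for an `L′`-antilipschitz `ψ`. [cite: Federbush1988PhaseCellIV, (A.17) p. 341; p. 339] -/
theorem supDist_le_mul_comp {ψ : Y → Z} {K : ℝ≥0} (hψ : AntilipschitzWith K ψ) (g₁ g₂ : W → Y) :
    supDist g₁ g₂ ≤ K * supDist (ψ ∘ g₁) (ψ ∘ g₂) := by
  simp only [supDist]
  refine iSup_le fun x => ?_
  calc edist (g₁ x) (g₂ x) ≤ K * edist (ψ (g₁ x)) (ψ (g₂ x)) := hψ (g₁ x) (g₂ x)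
    _ ≤ K * ⨆ x, edist ((ψ ∘ g₁) x) ((ψ ∘ g₂) x) := by
        gcongr
        exact le_iSup (fun x => edist ((ψ ∘ g₁) x) ((ψ ∘ g₂) x)) x

end Comparison

/-! ## §2 Bi-Lipschitz embeddings onto a compact `C^∞` submanifold of `Rᵗ` with its intrinsic metric -/

variable {M : Type*} {t : ℕ}

/-- **A bi-Lipschitz embedding in the METRIC sense**: a map `e : M → Rᵗ` of an (extended pseudo-)metric space `M` — the record
context of `ThmA1`/`ThmA2` (p242861), where `edist` IS the Riemannian distance (`IsRiemannianManifold`) — whose image is an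
embedded `C^∞` submanifold of dimension `d` and whose corestriction `M → (e(M), d)` onto the image WITH ITS INTRINSIC DISTANCE is
Lipschitz AND antilipschitz (print, p. 339: «universally bounded differential, and likewise the inverse mappings have universally
bounded differential»; p. 342: «We now embed `M` in some Euclidean space `Rᵗ`»).  Every smooth embedding of a compact Riemannian
manifold is such an `e` (bounded distortion of lengths of curves by compactness — formalised in the companion file
`PhaseCellIVWhitneyBiLipschitz`: `isBiLipschitzEmbedding_of_contMDiff`, `exists_isBiLipschitzEmbedding` (p334327); in this file the
embedding is an explicit HYPOTHESIS, weaker than the isometric one of `IsMetricEmbedding`, see `IsMetricEmbedding.isBiLipschitzEmbedding`).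
[cite: Federbush1988PhaseCellIV, Theorem A.1 p. 339; p. 342] -/
structure IsBiLipschitzEmbedding [PseudoEMetricSpace M] (d : ℕ) (e : M → EuclideanSpace ℝ (Fin t)) : Prop where
  /-- the image is an embedded `C^∞` submanifold of `Rᵗ` of dimension `d` (in coordinates `EuclideanSpace.equiv`) -/
  submanifold : IsSubmanifoldOfDim d (EuclideanSpace.equiv (Fin t) ℝ '' range e)
  /-- `M → (e(M), d)` is Lipschitz («universally bounded differential») -/
  lipschitz : ∃ L : ℝ≥0, LipschitzWith L (toIntrinsicRange e)
  /-- `M → (e(M), d)` is antilipschitz («likewise the inverse mappings») -/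
  antilipschitz : ∃ L' : ℝ≥0, AntilipschitzWith L' (toIntrinsicRange e)

namespace IsBiLipschitzEmbedding

section Pseudo

variable [PseudoEMetricSpace M] {d : ℕ} {e : M → EuclideanSpace ℝ (Fin t)}

/-- `e` is continuous into `Rᵗ` (Lipschitz into `(e(M), d)`, and chord ≤ geodesic). [cite: Federbush1988PhaseCellIV, p. 342] -/
theorem continuous (h : IsBiLipschitzEmbedding d e) : Continuous e := by
  obtain ⟨L, hL⟩ := h.lipschitz
  have : e = (fun p : ↥(range e) => (p : EuclideanSpace ℝ (Fin t))) ∘ ofIntrinsic (range e) ∘ toIntrinsicRange e := rfl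
  rw [this]
  exact continuous_subtype_val.comp (continuous_ofIntrinsic.comp hL.continuous)

/-- The image of a compact `M` is compact. [cite: Federbush1988PhaseCellIV, p. 342] -/
theorem isCompact_range [CompactSpace M] (h : IsBiLipschitzEmbedding d e) : IsCompact (range e) :=
  _root_.isCompact_range h.continuous

/-- The Lipschitz constant may be taken `≥ 1`. [cite: Federbush1988PhaseCellIV, p. 339] -/
theorem exists_lipschitz_one_le (h : IsBiLipschitzEmbedding d e) : ∃ L : ℝ≥0, 1 ≤ L ∧ LipschitzWith L (toIntrinsicRange e) := by
  obtain ⟨L, hL⟩ := h.lipschitz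
  exact ⟨max L 1, le_max_right _ _, hL.weaken (le_max_left _ _)⟩

end Pseudo

section Emetric

variable [EMetricSpace M] {d : ℕ} {e : M → EuclideanSpace ℝ (Fin t)}

/-- On an extended METRIC space `e` is injective (antilipschitz maps are). [cite: Federbush1988PhaseCellIV, p. 342] -/
theorem injective (h : IsBiLipschitzEmbedding d e) : Function.Injective e := by
  obtain ⟨L', hL'⟩ := h.antilipschitz
  exact fun _ _ hxy => hL'.injective (Subtype.ext hxy)

/-- `ofIntrinsicRange e ∘ toIntrinsicRange e = id`. [cite: Federbush1988PhaseCellIV, p. 342] -/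
theorem ofIntrinsicRange_toIntrinsicRange (h : IsBiLipschitzEmbedding d e) (x : M) :
    ofIntrinsicRange e (toIntrinsicRange e x) = x :=
  h.injective (apply_ofIntrinsicRange e (toIntrinsicRange e x))

end Emetric

end IsBiLipschitzEmbedding

/-- **The isometric hypothesis of §10 is the case `L = L′ = 1`**: every `IsMetricEmbedding` is an `IsBiLipschitzEmbedding`.
[cite: Federbush1988PhaseCellIV, Theorem A.1 p. 339; p. 342] -/
theorem IsMetricEmbedding.isBiLipschitzEmbedding [PseudoEMetricSpace M] {d : ℕ} {e : M → EuclideanSpace ℝ (Fin t)}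
    (h : IsMetricEmbedding d e) : IsBiLipschitzEmbedding d e :=
  ⟨h.submanifold, ⟨1, h.isometry_toIntrinsicRange.lipschitz⟩, ⟨1, h.isometry_toIntrinsicRange.antilipschitz⟩⟩

/-- NON-VACUITY, the model case: the inclusion of a `C^∞` submanifold `M ⊂ Rᵗ` carrying its intrinsic distance is a
bi-Lipschitz embedding. [cite: Federbush1988PhaseCellIV, p. 342] -/
theorem IsBiLipschitzEmbedding.inclusion {M : Set (EuclideanSpace ℝ (Fin t))} {d : ℕ}
    (hM : IsSubmanifoldOfDim d (EuclideanSpace.equiv (Fin t) ℝ '' M)) :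
    IsBiLipschitzEmbedding d (fun p : Intrinsic M => ((ofIntrinsic M p : ↥M) : EuclideanSpace ℝ (Fin t))) :=
  (IsMetricEmbedding.inclusion hM).isBiLipschitzEmbedding

/-! ## §3 The record decls `ThmA1 n J M`, `ThmA2 n J M` under a bi-Lipschitz embedding -/

section Record

open Bundle

variable {E : Type*} [NormedAddCommGroup E] [NormedSpace ℝ E] {H : Type*} [TopologicalSpace H] (J : ModelWithCorners ℝ E H)
  [EMetricSpace M] [ChartedSpace H M] [IsManifold J ∞ M] [RiemannianBundle (fun (x : M) ↦ TangentSpace J x)]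
  [IsContMDiffRiemannianBundle J ∞ E (fun (x : M) ↦ TangentSpace J x)] [IsRiemannianManifold J M] [CompactSpace M]
  [BoundarylessManifold J M] {d : ℕ} {e : M → EuclideanSpace ℝ (Fin t)}

/-- **The RECORD decl `ThmA1 n J M` (Theorem A.1 for an abstract compact Riemannian manifold, p242861) HOLDS for every `M` that
embeds BI-LIPSCHITZLY — as a metric space — onto a compact `C^∞` submanifold of some `Rᵗ` with its intrinsic metric** (every
cap `c₁`, every cube dimension `n`): if `toIntrinsicRange e` is `L`-Lipschitz and `L′`-antilipschitz, the constant is `c₂′(c₁) =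
L′·c₂(L·c₁)·L` with `c₂` that of `thmA1Len_of_submanifold` for the image — print's «(A.2) will hold in the context of the theorem
for some constant `c′`» (p. 339).  «homotopically trivial» is preserved by the continuous `e`. [cite: Federbush1988PhaseCellIV,
Theorem A.1 (A.1)–(A.2) p. 339; p. 342] -/
theorem thmA1_of_isBiLipschitzEmbedding (h : IsBiLipschitzEmbedding d e) (n : ℕ) : ThmA1 n J M := by
  obtain ⟨L, hL⟩ := h.lipschitz
  obtain ⟨L', hL'⟩ := h.antilipschitz
  intro c₁
  obtain ⟨c₂, hc⟩ := thmA1Len_of_submanifold h.isCompact_range h.submanifold n (L * c₁)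
  refine ⟨L' * c₂ * L, fun f hf hΛ => ?_⟩
  set ê : C(M, Intrinsic (range e)) := ⟨toIntrinsicRange e, hL.continuous⟩ with hê_def
  have hΛ' : lipConst (ê.comp f) ≤ L * lipConst f := lipConst_comp_le_mul hL f
  have hcap : lipConst (ê.comp f) ≤ (L * c₁ : ℝ≥0) := by
    rw [ENNReal.coe_mul]
    exact hΛ'.trans (by gcongr)
  obtain ⟨g, hext, hLip⟩ := hc (ê.comp f) (hf.comp_right ê) hcap
  have hg : g = toIntrinsicRange e ∘ (ofIntrinsicRange e ∘ g) :=
    funext fun x => (toIntrinsicRange_ofIntrinsicRange e (g x)).symm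
  refine ⟨ofIntrinsicRange e ∘ g, fun x => ?_, ?_⟩
  · rw [Function.comp_apply, hext x]
    exact h.ofIntrinsicRange_toIntrinsicRange (f x)
  · calc lipConst (ofIntrinsicRange e ∘ g) ≤ L' * lipConst (toIntrinsicRange e ∘ (ofIntrinsicRange e ∘ g)) :=
          lipConst_le_mul_comp hL' _
      _ = L' * lipConst g := by rw [← hg]
      _ ≤ L' * (c₂ * lipConst (ê.comp f)) := by gcongr
      _ ≤ L' * (c₂ * (L * lipConst f)) := by gcongr
      _ = (L' * c₂ * L : ℝ≥0) * lipConst f := by push_cast; ring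

/-- **The RECORD decl `ThmA2 n J M` (Theorem A.2 for an abstract compact Riemannian manifold, p242861) HOLDS for every `M` that
embeds bi-Lipschitzly (metric sense) onto a compact `C^∞` submanifold of some `Rᵗ` with its intrinsic metric** (every ball
dimension `n`): with `L ≥ 1`, `L′` the two constants and `ε_M, c₁, c₂` those of `thmA2Len_of_submanifold` for the image, the
abstract constants are `ε_M/L`, `L′c₁L`, `L′c₂L`. [cite: Federbush1988PhaseCellIV, Theorem A.2 (A.17)–(A.19) p. 341; p. 339; p. 342] -/
theorem thmA2_of_isBiLipschitzEmbedding (h : IsBiLipschitzEmbedding d e) (n : ℕ) : ThmA2 n J M := by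
  obtain ⟨L, hL1, hL⟩ := h.exists_lipschitz_one_le
  obtain ⟨L', hL'⟩ := h.antilipschitz
  have hL0 : L ≠ 0 := (zero_lt_one.trans_le hL1).ne'
  obtain ⟨εM, hε, c₁, c₂, H⟩ := thmA2Len_of_submanifold h.isCompact_range h.submanifold n
  refine ⟨εM / L, div_pos hε (zero_lt_one.trans_le hL1), L' * c₁ * L, L' * c₂ * L, fun f₁ f₂ f₁e hext hδ => ?_⟩
  -- the pushed-forward data on the image
  have hd : supDist (toIntrinsicRange e ∘ f₁) (toIntrinsicRange e ∘ f₂) ≤ L * supDist f₁ f₂ := supDist_comp_le_mul hL f₁ f₂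
  have hdε : supDist (toIntrinsicRange e ∘ f₁) (toIntrinsicRange e ∘ f₂) ≤ εM := by
    calc supDist (toIntrinsicRange e ∘ f₁) (toIntrinsicRange e ∘ f₂) ≤ L * supDist f₁ f₂ := hd
      _ ≤ L * (εM / L : ℝ≥0) := by gcongr
      _ = εM := by rw [← ENNReal.coe_mul, mul_div_cancel₀ _ hL0]
  obtain ⟨g, hext', h18, h19⟩ := H (toIntrinsicRange e ∘ f₁) (toIntrinsicRange e ∘ f₂) (toIntrinsicRange e ∘ f₁e)
    (fun x => by simp only [Function.comp_apply, hext x]) hdε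
  have hg : g = toIntrinsicRange e ∘ (ofIntrinsicRange e ∘ g) :=
    funext fun x => (toIntrinsicRange_ofIntrinsicRange e (g x)).symm
  refine ⟨ofIntrinsicRange e ∘ g, fun x => ?_, ?_, ?_⟩
  · rw [Function.comp_apply, hext' x]
    exact h.ofIntrinsicRange_toIntrinsicRange (f₂ x)
  · -- (A.18)
    calc supDist f₁e (ofIntrinsicRange e ∘ g)
        ≤ L' * supDist (toIntrinsicRange e ∘ f₁e) (toIntrinsicRange e ∘ (ofIntrinsicRange e ∘ g)) :=
          supDist_le_mul_comp hL' _ _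
      _ = L' * supDist (toIntrinsicRange e ∘ f₁e) g := by rw [← hg]
      _ ≤ L' * (c₁ * supDist (toIntrinsicRange e ∘ f₁) (toIntrinsicRange e ∘ f₂)) := by gcongr
      _ ≤ L' * (c₁ * (L * supDist f₁ f₂)) := by gcongr
      _ = (L' * c₁ * L : ℝ≥0) * supDist f₁ f₂ := by push_cast; ring
  · -- (A.19)
    calc lipConst (ofIntrinsicRange e ∘ g)
        ≤ L' * lipConst (toIntrinsicRange e ∘ (ofIntrinsicRange e ∘ g)) := lipConst_le_mul_comp hL' _
      _ = L' * lipConst g := by rw [← hg]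
      _ ≤ L' * (c₂ * (lipConst (toIntrinsicRange e ∘ f₁e) + supDist (toIntrinsicRange e ∘ f₁) (toIntrinsicRange e ∘ f₂) +
            lipConst (toIntrinsicRange e ∘ f₂))) := by gcongr
      _ ≤ L' * (c₂ * (L * lipConst f₁e + L * supDist f₁ f₂ + L * lipConst f₂)) := by
          gcongr
          · exact lipConst_comp_le_mul hL f₁e
          · exact lipConst_comp_le_mul hL f₂
      _ = (L' * c₂ * L : ℝ≥0) * (lipConst f₁e + supDist f₁ f₂ + lipConst f₂) := by push_cast; ring

/-- §10's theorem as a corollary: `IsMetricEmbedding d e → ThmA1 n J M` (via `IsMetricEmbedding.isBiLipschitzEmbedding`).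
[cite: Federbush1988PhaseCellIV, Theorem A.1 (A.1)–(A.2) p. 339; p. 342] -/
theorem thmA1_of_isMetricEmbedding' (h : IsMetricEmbedding d e) (n : ℕ) : ThmA1 n J M :=
  thmA1_of_isBiLipschitzEmbedding J h.isBiLipschitzEmbedding n

/-- §10's theorem as a corollary: `IsMetricEmbedding d e → ThmA2 n J M`. [cite: Federbush1988PhaseCellIV, Theorem A.2
(A.17)–(A.19) p. 341; p. 342] -/
theorem thmA2_of_isMetricEmbedding' (h : IsMetricEmbedding d e) (n : ℕ) : ThmA2 n J M :=
  thmA2_of_isBiLipschitzEmbedding J h.isBiLipschitzEmbedding n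

end Record

end PhaseCellIVAppA

end

end Literature.MathematicalPhysics.QuantumFieldTheory.Federbush1986
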